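import Literature.MathematicalPhysics.QuantumFieldTheory.Balaban1983to89.B9BackgroundsKLevelV1P

/-!
# `Balaban1983to89.B9BackgroundsKLevelV1R` — Stage-3′(Y) GEOMETRY∕INDEX layer, MODULE 3-R: the CLASS-PARAMETRIC member background carrier `bg9YR R₁ R₂ x : B9.Backgrounds`
# (the regularity predicates (3.35)–(3.36) as PARAMETERS `R₁ R₂ : RegFamY …`), its two readings `bg9Y` (MODULE 3, `rfl`) and `bg9YP` (MODULE 3-P = print's class, `rfl`),
# and the R-generic fieldwise re-typing of the [B9] operator records

B9 = T. Bałaban, *Propagators for lattice gauge theories in a background field*, Commun. Math. Phys. **99** (1985) 389–434 [Balaban1985BackgroundPropagators].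
pub-ymgap Track A, node N06 = `Dag.B9_main`; seat `pub-ymgap-node00-def-Y` g7 (OWNER of the `OpsY` instance at the record); plan of record dag-lead CASCADE-R.
APPEND-ONLY companion of MODULE 2∕3 (`B9BackgroundsKLevelV1`, `B9PinMembersKLevelV1`) and MODULE 2-P∕3-P (`B9BackgroundsKLevelV1P`) — all untouched, consumed by name.
DEFINITIONS + `rfl` bookkeeping; nothing of [B9] asserted; count-neutral; N06 NOT discharged.

WHY A CLASS PARAMETER.  The regularity classes (3.35)–(3.36) of [B9] p.396 enter the typed statements of Thms 3.1–3.15 ONLY as the hypothesis predicates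
`(bg i).Reg335 c α₀ U` ∕ `(bg i).Reg336 c α₀ U` of a background carrier `bg : I → B9.Backgrounds`; the configuration type, `1`, the product and the complex classes
(3.37)–(3.38) are the same for every reading of the cube class 𝒞ⱼ.  Two readings are on the tree: MODULE 2's Lean-side small-cube class (`bg9K`; member carrier `bg9Y`,
the conjunction at the member's index and at its second pin) and MODULE 2-P's class of print («O(1) ≧ 10» open-ended, per-cube constant; `bg9KP`, `bg9YP`).  This file
types the member carrier ONCE over a PARAMETER `R₁ R₂ : RegFamY …` (a pair of predicate families `R x c α₀ U : Prop` on the members' configurations):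
`bg9YR 𝔸 G R₁ R₂ x := { bg9K 𝔸 G x.toKIdx with Reg335 := R₁ x, Reg336 := R₂ x }`, and records the two DEFINITIONAL identifications
`bg9Y 𝔸 G x = bg9YR 𝔸 G (regY335 𝔸 G) (regY336 𝔸 G) x` and `bg9YP 𝔸 G x = bg9YR 𝔸 G (regYP335 𝔸 G) (regYP336 𝔸 G) x` (both `rfl`).  Consequently a [B9]
statement typed or proved ONCE at a generic `(R₁, R₂)` specialises by `rfl` ∕ `exact` to its `bg9Y` edition AND to its `bg9YP` edition (and to any later amendment of
the class), instead of being re-pressed per class (dag-lead CASCADE-R: «class level — one edition, one press»).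

THE OPERATOR RECORDS.  The six record structures of `B9` (`KernelFamily`, `SiteKernel`, `FineKernel`, `RWExpansion`, `RWKernelExpansion`, `HKernel`) read a background
carrier ONLY through its configuration type `B.Cfg`, and `(bg9YR 𝔸 G R₁ R₂ x).Cfg = (bg9Y 𝔸 G x).Cfg` DEFINITIONALLY (`bg9YR_Cfg_eq`, `rfl`; likewise `one`, `mul`,
(3.37), (3.38)); §1 re-types each record FIELDWISE at generic `(R₁, R₂)` (`kernelFamilyR K := ⟨K.e, K.h1, K.e4, K.h2, K.l2, K.glob⟩`, …; inverses `kernelFamilyRY`,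
`hKernelRY`; all round trips and field lemmas `rfl`; at MODULE 3's families the re-typing is the identity, `kernelFamilyR_regY`), so an operator layer typed over
`bg9Y` (MODULE 5's `OperatorLayerY`, NODE 00's instance of record) is read over `bg9YR R₁ R₂` with NO kernel entry changed.

WHAT IS DEFINED ∕ PROVED.
* §0 `RegFamY`; **`bg9YR`**; the four families `regY335 ∕ regY336` (MODULE 3's reading) and `regYP335 ∕ regYP336` (MODULE 3-P's reading); the identifications
  **`bg9Y_eq_bg9YR`**, **`bg9YP_eq_bg9YR`** (`rfl`); the carrier API `bg9YR_Cfg_eq ∕ _one_eq ∕ _mul_eq ∕ _reg335_iff ∕ _reg336_iff ∕ _cplx337_iff ∕ _cplx338_iff`; the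
  `U ≡ 1` facts `regY335_one` (`0 < c`, MODULE 3's `reg335Y_one`) and `regYP335_one` (any `c`, MODULE 3-P's `reg335YP_one`); the two CLASS AXIOMS a pinned proof
  may read — `MemOfFam G R` («`G`-valued», what `hU.1.1` reads at `bg9Y`) and `Imp336335 R₁ R₂` ((3.36) ⟹ (3.35)) — with their instances at both readings
  (`memOfFam_regY335 ∕ _regYP335`, `imp336335_regY ∕ _regYP`) and the carrier readings `mem_of_reg335R`, `reg336R_reg335R`.
* §1 the re-typings `kernelFamilyR ∕ kernelFamilyRY`, `siteKernelR`, `fineKernelR`, `rwExpansionR`, `rwKernelExpansionR`, `hKernelR ∕ hKernelRY`, field lemmas, round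
  trips, `kernelFamilyR_regY`, `hKernelR_regY` (`rfl`).
CONSUMERS (pub-ymgap bus, dag-lead CASCADE-R): MODULE 5-R `B9PinCarriersKLevelV1R` (the bundle `carriersYR R₁ R₂ ops` and the knit); the owners of the pinned upstream
theorems of the N06 certificate, who re-press ONCE at generic `(R₁, R₂)` (`bg9Y ↦ bg9YR 𝔸 G R₁ R₂`, kernels via the §1 re-typings); dag-n06-d's successor (edition 8).
HONEST SCOPE: the class is a PARAMETER; no estimate; one finite lattice programme; NOT continuum ∕ OS ∕ mass gap ∕ Clay.  No `sorry`, no `axiom`, no `instance`, no `notation`.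
-/

noncomputable section

namespace Literature.MathematicalPhysics.QuantumFieldTheory.Balaban1983to89.B9BackgroundsKLevelV1R

open B6KLevelCensusIndexV1 (KIdx)
open B6GlobalChartV1 (PV)
open B9BackgroundsKLevelV1 (CfgV1 bg9K)
open B9PinMembersKLevelV1 (MemberY geo9Y bg9Y)
open B9BackgroundsKLevelV1P (bg9KP bg9YP)

/-! ## §0 The class-parametric member carrier `bg9YR R₁ R₂` and its two readings -/

/-- a REGULARITY FAMILY on the members: `R x c α₀ U : Prop` for a member `x`, a constant `c`, a time-step parameter `α₀` and a configuration `U` on the member's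
torus (the shape of `(bg9Y 𝔸 G x).Reg335` ∕ `.Reg336`). [cite: Balaban1985BackgroundPropagators, (3.35)–(3.36) p.396 (the regularity classes as predicates)] -/
abbrev RegFamY (d ℓ : ℕ) (hd : 1 ≤ d + 1) (hL : Odd (ℓ + 1) ∧ 1 < ℓ + 1) (b₀ b₁ : ℝ) (Mstar : ℕ) (𝔸 : Type) [NormedRing 𝔸] : Type _ :=
  ∀ x : MemberY d ℓ hd hL b₀ b₁ Mstar, ℝ → ℝ → CfgV1 (PV d ℓ x.m x.K hd hL) 𝔸 → Prop

variable {d ℓ : ℕ} {hd : 1 ≤ d + 1} {hL : Odd (ℓ + 1) ∧ 1 < ℓ + 1} {b₀ b₁ : ℝ} {Mstar : ℕ}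
variable {𝔸 : Type} [NormedRing 𝔸] [NormedAlgebra ℂ 𝔸] [CompleteSpace 𝔸] {G : Subgroup 𝔸ˣ}

variable (𝔸 G) in
/-- **THE CLASS-PARAMETRIC MEMBER CARRIER**: MODULE 2's `bg9K 𝔸 G x.toKIdx` (configurations, `1`, product, (3.37)–(3.38)) with the regularity predicates (3.35)–(3.36)
REPLACED BY THE PARAMETERS `R₁ x`, `R₂ x`. [cite: Balaban1985BackgroundPropagators, (3.35)–(3.38) p.396 (the classes of backgrounds; the cube class 𝒞ⱼ as a parameter)] -/
def bg9YR (R₁ R₂ : RegFamY d ℓ hd hL b₀ b₁ Mstar 𝔸) (x : MemberY d ℓ hd hL b₀ b₁ Mstar) : B9.Backgrounds :=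
  { bg9K 𝔸 G x.toKIdx with Reg335 := R₁ x, Reg336 := R₂ x }

variable (𝔸 G) in
/-- MODULE 3's reading of (3.35): MODULE 2's small-cube class at the member's index AND at its second pin. [cite: Balaban1985BackgroundPropagators, (3.35) p.396 (bookkeeping: MODULE 3's reading)] -/
def regY335 : RegFamY d ℓ hd hL b₀ b₁ Mstar 𝔸 := fun x c α₀ U => (bg9K 𝔸 G x.toKIdx).Reg335 c α₀ U ∧ (bg9K 𝔸 G x.snd).Reg335 c α₀ U

variable (𝔸 G) in
/-- MODULE 3's reading of (3.36). [cite: Balaban1985BackgroundPropagators, (3.36) p.396 (bookkeeping: MODULE 3's reading)] -/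
def regY336 : RegFamY d ℓ hd hL b₀ b₁ Mstar 𝔸 := fun x c α₀ U => (bg9K 𝔸 G x.toKIdx).Reg336 c α₀ U ∧ (bg9K 𝔸 G x.snd).Reg336 c α₀ U

variable (𝔸 G) in
/-- MODULE 3-P's reading of (3.35): PRINT's cube class («O(1) ≧ 10» open-ended, per-cube constant) at the member's index AND at its second pin.
[cite: Balaban1985BackgroundPropagators, (3.35) p.396 («a number ≧ 10»)] -/
def regYP335 : RegFamY d ℓ hd hL b₀ b₁ Mstar 𝔸 := fun x c α₀ U => (bg9KP 𝔸 G x.toKIdx).Reg335 c α₀ U ∧ (bg9KP 𝔸 G x.snd).Reg335 c α₀ U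

variable (𝔸 G) in
/-- MODULE 3-P's reading of (3.36). [cite: Balaban1985BackgroundPropagators, (3.36) p.396 («a number ≧ 10»)] -/
def regYP336 : RegFamY d ℓ hd hL b₀ b₁ Mstar 𝔸 := fun x c α₀ U => (bg9KP 𝔸 G x.toKIdx).Reg336 c α₀ U ∧ (bg9KP 𝔸 G x.snd).Reg336 c α₀ U

section Carrier

variable (R₁ R₂ : RegFamY d ℓ hd hL b₀ b₁ Mstar 𝔸) (x : MemberY d ℓ hd hL b₀ b₁ Mstar)

/-- **MODULE 3's member carrier IS the class-parametric carrier at MODULE 3's families** (definitionally).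
[cite: Balaban1985BackgroundPropagators, (3.35)–(3.38) p.396 (bookkeeping: the two readings of the cube class)] -/
theorem bg9Y_eq_bg9YR : bg9Y 𝔸 G x = bg9YR 𝔸 G (regY335 𝔸 G) (regY336 𝔸 G) x := rfl

/-- **MODULE 3-P's member carrier (print's class) IS the class-parametric carrier at MODULE 3-P's families** (definitionally).
[cite: Balaban1985BackgroundPropagators, (3.35)–(3.38) p.396 («a number ≧ 10»; bookkeeping)] -/
theorem bg9YP_eq_bg9YR : bg9YP 𝔸 G x = bg9YR 𝔸 G (regYP335 𝔸 G) (regYP336 𝔸 G) x := rfl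

/-- same configurations as MODULE 3's carrier. [cite: Balaban1985BackgroundPropagators, p.396 (bookkeeping)] -/
theorem bg9YR_Cfg_eq : (bg9YR 𝔸 G R₁ R₂ x).Cfg = (bg9Y 𝔸 G x).Cfg := rfl
/-- same `1`. [cite: Balaban1985BackgroundPropagators, p.396 (bookkeeping)] -/
theorem bg9YR_one_eq : (bg9YR 𝔸 G R₁ R₂ x).one = (bg9Y 𝔸 G x).one := rfl
/-- same product. [cite: Balaban1985BackgroundPropagators, p.396 (bookkeeping)] -/
theorem bg9YR_mul_eq : (bg9YR 𝔸 G R₁ R₂ x).mul = (bg9Y 𝔸 G x).mul := rfl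
/-- (3.35) at the carrier is the parameter `R₁`. [cite: Balaban1985BackgroundPropagators, (3.35) p.396 (bookkeeping)] -/
theorem bg9YR_reg335_iff (c α₀ : ℝ) (U : (bg9YR 𝔸 G R₁ R₂ x).Cfg) : (bg9YR 𝔸 G R₁ R₂ x).Reg335 c α₀ U ↔ R₁ x c α₀ U := Iff.rfl
/-- (3.36) at the carrier is the parameter `R₂`. [cite: Balaban1985BackgroundPropagators, (3.36) p.396 (bookkeeping)] -/
theorem bg9YR_reg336_iff (c α₀ : ℝ) (U : (bg9YR 𝔸 G R₁ R₂ x).Cfg) : (bg9YR 𝔸 G R₁ R₂ x).Reg336 c α₀ U ↔ R₂ x c α₀ U := Iff.rfl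
/-- (3.37) at the carrier is MODULE 3's. [cite: Balaban1985BackgroundPropagators, (3.37) p.396 (bookkeeping)] -/
theorem bg9YR_cplx337_iff (c : ℝ) (U V : (bg9YR 𝔸 G R₁ R₂ x).Cfg) : (bg9YR 𝔸 G R₁ R₂ x).Cplx337 c U V ↔ (bg9Y 𝔸 G x).Cplx337 c U V := Iff.rfl
/-- (3.38) at the carrier is MODULE 3's. [cite: Balaban1985BackgroundPropagators, (3.38) p.396 (bookkeeping)] -/
theorem bg9YR_cplx338_iff (c : ℝ) (U V : (bg9YR 𝔸 G R₁ R₂ x).Cfg) : (bg9YR 𝔸 G R₁ R₂ x).Cplx338 c U V ↔ (bg9Y 𝔸 G x).Cplx338 c U V := Iff.rfl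

/-- `U ≡ 1` is in MODULE 3's reading of (3.35) (for `0 < c`). [cite: Balaban1985BackgroundPropagators, (3.35) p.396 (the trivial background)] -/
theorem regY335_one [NormOneClass 𝔸] {c α₀ : ℝ} (hc : 0 < c) (hα : 0 < α₀) :
    regY335 𝔸 G x c α₀ (bg9YR 𝔸 G (regY335 𝔸 G) (regY336 𝔸 G) x).one :=
  B9PinMembersKLevelV1.reg335Y_one x hc hα

/-- `U ≡ 1` is in MODULE 3-P's reading of (3.35) (any `c`). [cite: Balaban1985BackgroundPropagators, (3.35) p.396 (the trivial background; «≧ 10»)] -/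
theorem regYP335_one [NormOneClass 𝔸] (c : ℝ) {α₀ : ℝ} (hα : 0 < α₀) :
    regYP335 𝔸 G x c α₀ (bg9YR 𝔸 G (regYP335 𝔸 G) (regYP336 𝔸 G) x).one :=
  B9BackgroundsKLevelV1P.reg335YP_one x c hα

end Carrier

section ClassAxioms

/-- a regularity family is **`G`-VALUED**: a configuration in the class takes values in `G` (the first conjunct of MODULE 2's ∕ MODULE 2-P's bodies; what a proof
pinned at `bg9Y` reads as `hU.1.1`). [cite: Balaban1985BackgroundPropagators, (3.35) p.396 («U with values in G»)] -/
def MemOfFam (G : Subgroup 𝔸ˣ) (R : RegFamY d ℓ hd hL b₀ b₁ Mstar 𝔸) : Prop :=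
  ∀ (x : MemberY d ℓ hd hL b₀ b₁ Mstar) (c α₀ : ℝ) (U : CfgV1 (PV d ℓ x.m x.K hd hL) 𝔸), R x c α₀ U → ∀ μ y, U μ y ∈ G

/-- in a pair of regularity families **(3.36) IMPLIES (3.35)**. [cite: Balaban1985BackgroundPropagators, (3.35)–(3.36) p.396 (the second class is contained in the first)] -/
def Imp336335 (R₁ R₂ : RegFamY d ℓ hd hL b₀ b₁ Mstar 𝔸) : Prop :=
  ∀ (x : MemberY d ℓ hd hL b₀ b₁ Mstar) (c α₀ : ℝ) (U : CfgV1 (PV d ℓ x.m x.K hd hL) 𝔸), R₂ x c α₀ U → R₁ x c α₀ U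

/-- MODULE 3's reading of (3.35) is `G`-valued (MODULE 2's `mem_of_reg335`). [cite: Balaban1985BackgroundPropagators, (3.35) p.396 (bookkeeping)] -/
theorem memOfFam_regY335 : MemOfFam G (regY335 (hd := hd) (hL := hL) (b₀ := b₀) (b₁ := b₁) (Mstar := Mstar) 𝔸 G) :=
  fun x _ _ _ h => B9BackgroundsKLevelV1.mem_of_reg335 x.toKIdx h.1

/-- MODULE 3-P's reading of (3.35) is `G`-valued (MODULE 2-P's `mem_of_reg335P`). [cite: Balaban1985BackgroundPropagators, (3.35) p.396 («≧ 10»; bookkeeping)] -/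
theorem memOfFam_regYP335 : MemOfFam G (regYP335 (hd := hd) (hL := hL) (b₀ := b₀) (b₁ := b₁) (Mstar := Mstar) 𝔸 G) :=
  fun x _ _ _ h => B9BackgroundsKLevelV1P.mem_of_reg335P x.toKIdx h.1

/-- at MODULE 3's readings (3.36) implies (3.35) (MODULE 3's `reg336Y_reg335Y`). [cite: Balaban1985BackgroundPropagators, (3.35)–(3.36) p.396 (bookkeeping)] -/
theorem imp336335_regY : Imp336335 (regY335 (hd := hd) (hL := hL) (b₀ := b₀) (b₁ := b₁) (Mstar := Mstar) 𝔸 G) (regY336 𝔸 G) :=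
  fun x _ _ _ h => B9PinMembersKLevelV1.reg336Y_reg335Y x h

/-- at MODULE 3-P's readings (3.36) implies (3.35) (MODULE 3-P's `reg336YP_reg335YP`). [cite: Balaban1985BackgroundPropagators, (3.35)–(3.36) p.396 («≧ 10»; bookkeeping)] -/
theorem imp336335_regYP : Imp336335 (regYP335 (hd := hd) (hL := hL) (b₀ := b₀) (b₁ := b₁) (Mstar := Mstar) 𝔸 G) (regYP336 𝔸 G) :=
  fun x _ _ _ h => B9BackgroundsKLevelV1P.reg336YP_reg335YP x h

/-- reading a `G`-valued family at the carrier: a configuration in the carrier's (3.35) takes values in `G`.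
[cite: Balaban1985BackgroundPropagators, (3.35) p.396 (bookkeeping)] -/
theorem mem_of_reg335R {R₁ R₂ : RegFamY d ℓ hd hL b₀ b₁ Mstar 𝔸} (hG : MemOfFam G R₁) (x : MemberY d ℓ hd hL b₀ b₁ Mstar) {c α₀ : ℝ}
    {U : (bg9YR 𝔸 G R₁ R₂ x).Cfg} (h : (bg9YR 𝔸 G R₁ R₂ x).Reg335 c α₀ U) (μ : Fin (d + 1)) (y : _) : U μ y ∈ G :=
  hG x c α₀ U h μ y

/-- reading (3.36) ⟹ (3.35) at the carrier. [cite: Balaban1985BackgroundPropagators, (3.35)–(3.36) p.396 (bookkeeping)] -/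
theorem reg336R_reg335R {R₁ R₂ : RegFamY d ℓ hd hL b₀ b₁ Mstar 𝔸} (h21 : Imp336335 R₁ R₂) (x : MemberY d ℓ hd hL b₀ b₁ Mstar) {c α₀ : ℝ}
    {U : (bg9YR 𝔸 G R₁ R₂ x).Cfg} (h : (bg9YR 𝔸 G R₁ R₂ x).Reg336 c α₀ U) : (bg9YR 𝔸 G R₁ R₂ x).Reg335 c α₀ U :=
  h21 x c α₀ U h

end ClassAxioms

/-! ## §1 Fieldwise re-typing of the operator layer's records over `bg9YR R₁ R₂` (same configurations, same entries) -/

section Retype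

variable {R₁ R₂ : RegFamY d ℓ hd hL b₀ b₁ Mstar 𝔸} {x : MemberY d ℓ hd hL b₀ b₁ Mstar}

variable (R₁ R₂) in
/-- a kernel family over `bg9Y x` IS one over `bg9YR R₁ R₂ x` (same configuration type; entries copied). [cite: Balaban1985BackgroundPropagators, (3.42)–(3.47) pp.397–398 (bookkeeping)] -/
def kernelFamilyR (K : B9.KernelFamily (geo9Y x) (bg9Y 𝔸 G x)) : B9.KernelFamily (geo9Y x) (bg9YR 𝔸 G R₁ R₂ x) :=
  ⟨K.e, K.h1, K.e4, K.h2, K.l2, K.glob⟩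

/-- … and conversely. [cite: Balaban1985BackgroundPropagators, (3.42)–(3.47) pp.397–398 (bookkeeping)] -/
def kernelFamilyRY (K : B9.KernelFamily (geo9Y x) (bg9YR 𝔸 G R₁ R₂ x)) : B9.KernelFamily (geo9Y x) (bg9Y 𝔸 G x) :=
  ⟨K.e, K.h1, K.e4, K.h2, K.l2, K.glob⟩

/-- round trip. [cite: Balaban1985BackgroundPropagators, p.397 (bookkeeping)] -/
theorem kernelFamilyRY_kernelFamilyR (K : B9.KernelFamily (geo9Y x) (bg9Y 𝔸 G x)) : kernelFamilyRY (kernelFamilyR R₁ R₂ K) = K := rfl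
/-- round trip. [cite: Balaban1985BackgroundPropagators, p.397 (bookkeeping)] -/
theorem kernelFamilyR_kernelFamilyRY (K : B9.KernelFamily (geo9Y x) (bg9YR 𝔸 G R₁ R₂ x)) : kernelFamilyR R₁ R₂ (kernelFamilyRY K) = K := rfl
/-- same entries (3.42). [cite: Balaban1985BackgroundPropagators, (3.42) p.397 (bookkeeping)] -/
theorem kernelFamilyR_e (K : B9.KernelFamily (geo9Y x) (bg9Y 𝔸 G x)) : (kernelFamilyR R₁ R₂ K).e = K.e := rfl
/-- same entries (3.43). [cite: Balaban1985BackgroundPropagators, (3.43) p.397 (bookkeeping)] -/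
theorem kernelFamilyR_h1 (K : B9.KernelFamily (geo9Y x) (bg9Y 𝔸 G x)) : (kernelFamilyR R₁ R₂ K).h1 = K.h1 := rfl
/-- same entries (3.44). [cite: Balaban1985BackgroundPropagators, (3.44) p.398 (bookkeeping)] -/
theorem kernelFamilyR_e4 (K : B9.KernelFamily (geo9Y x) (bg9Y 𝔸 G x)) : (kernelFamilyR R₁ R₂ K).e4 = K.e4 := rfl
/-- same entries (3.45). [cite: Balaban1985BackgroundPropagators, (3.45) p.398 (bookkeeping)] -/
theorem kernelFamilyR_h2 (K : B9.KernelFamily (geo9Y x) (bg9Y 𝔸 G x)) : (kernelFamilyR R₁ R₂ K).h2 = K.h2 := rfl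
/-- same entries (3.46). [cite: Balaban1985BackgroundPropagators, (3.46) p.398 (bookkeeping)] -/
theorem kernelFamilyR_l2 (K : B9.KernelFamily (geo9Y x) (bg9Y 𝔸 G x)) : (kernelFamilyR R₁ R₂ K).l2 = K.l2 := rfl
/-- same entries (3.47). [cite: Balaban1985BackgroundPropagators, (3.47) p.398 (bookkeeping)] -/
theorem kernelFamilyR_glob (K : B9.KernelFamily (geo9Y x) (bg9Y 𝔸 G x)) : (kernelFamilyR R₁ R₂ K).glob = K.glob := rfl

variable (R₁ R₂) in
/-- a site kernel over `bg9Y x` IS one over `bg9YR R₁ R₂ x`. [cite: Balaban1985BackgroundPropagators, (3.48) p.398 (bookkeeping)] -/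
def siteKernelR (C : B9.SiteKernel (geo9Y x) (bg9Y 𝔸 G x)) : B9.SiteKernel (geo9Y x) (bg9YR 𝔸 G R₁ R₂ x) :=
  ⟨C.ker⟩

/-- same kernel. [cite: Balaban1985BackgroundPropagators, (3.48) p.398 (bookkeeping)] -/
theorem siteKernelR_ker (C : B9.SiteKernel (geo9Y x) (bg9Y 𝔸 G x)) : (siteKernelR R₁ R₂ C).ker = C.ker := rfl

variable (R₁ R₂) in
/-- a fine kernel over `bg9Y x` IS one over `bg9YR R₁ R₂ x`. [cite: Balaban1985BackgroundPropagators, (3.49) p.399 (bookkeeping)] -/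
def fineKernelR (P : B9.FineKernel (geo9Y x) (bg9Y 𝔸 G x)) : B9.FineKernel (geo9Y x) (bg9YR 𝔸 G R₁ R₂ x) :=
  ⟨P.ker⟩

/-- same kernel. [cite: Balaban1985BackgroundPropagators, (3.49) p.399 (bookkeeping)] -/
theorem fineKernelR_ker (P : B9.FineKernel (geo9Y x) (bg9Y 𝔸 G x)) : (fineKernelR R₁ R₂ P).ker = P.ker := rfl

variable (R₁ R₂) in
/-- a random-walk expansion over `bg9Y x` IS one over `bg9YR R₁ R₂ x`. [cite: Balaban1985BackgroundPropagators, (3.90) p.409 (bookkeeping)] -/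
def rwExpansionR (E : B9.RWExpansion (geo9Y x) (bg9Y 𝔸 G x)) : B9.RWExpansion (geo9Y x) (bg9YR 𝔸 G R₁ R₂ x) :=
  ⟨E.Walk, E.wlen, E.first, E.last, E.wdist, E.term, E.LocDep, E.Converges⟩

/-- same walk terms. [cite: Balaban1985BackgroundPropagators, (3.90) p.409 (bookkeeping)] -/
theorem rwExpansionR_term (E : B9.RWExpansion (geo9Y x) (bg9Y 𝔸 G x)) : (rwExpansionR R₁ R₂ E).term = E.term := rfl

variable (R₁ R₂) in
/-- a random-walk kernel expansion over `bg9Y x` IS one over `bg9YR R₁ R₂ x`. [cite: Balaban1985BackgroundPropagators, (3.98)–(3.99) p.412 (bookkeeping)] -/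
def rwKernelExpansionR (E : B9.RWKernelExpansion (geo9Y x) (bg9Y 𝔸 G x)) : B9.RWKernelExpansion (geo9Y x) (bg9YR 𝔸 G R₁ R₂ x) :=
  ⟨E.Walk, E.wlen, E.wdist, E.kterm, E.LocDep, E.Converges⟩

/-- same walk terms. [cite: Balaban1985BackgroundPropagators, (3.98)–(3.99) p.412 (bookkeeping)] -/
theorem rwKernelExpansionR_kterm (E : B9.RWKernelExpansion (geo9Y x) (bg9Y 𝔸 G x)) : (rwKernelExpansionR R₁ R₂ E).kterm = E.kterm := rfl

variable (R₁ R₂) in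
/-- an `H`-kernel over `bg9Y x` IS one over `bg9YR R₁ R₂ x`. [cite: Balaban1985BackgroundPropagators, (3.133) p.422 (bookkeeping)] -/
def hKernelR (H : B9.HKernel (geo9Y x) (bg9Y 𝔸 G x)) : B9.HKernel (geo9Y x) (bg9YR 𝔸 G R₁ R₂ x) :=
  ⟨H.e, H.h⟩

/-- … and conversely. [cite: Balaban1985BackgroundPropagators, (3.133) p.422 (bookkeeping)] -/
def hKernelRY (H : B9.HKernel (geo9Y x) (bg9YR 𝔸 G R₁ R₂ x)) : B9.HKernel (geo9Y x) (bg9Y 𝔸 G x) :=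
  ⟨H.e, H.h⟩

/-- round trip. [cite: Balaban1985BackgroundPropagators, p.422 (bookkeeping)] -/
theorem hKernelRY_hKernelR (H : B9.HKernel (geo9Y x) (bg9Y 𝔸 G x)) : hKernelRY (hKernelR R₁ R₂ H) = H := rfl
/-- round trip. [cite: Balaban1985BackgroundPropagators, p.422 (bookkeeping)] -/
theorem hKernelR_hKernelRY (H : B9.HKernel (geo9Y x) (bg9YR 𝔸 G R₁ R₂ x)) : hKernelR R₁ R₂ (hKernelRY H) = H := rfl
/-- same entries. [cite: Balaban1985BackgroundPropagators, (3.133) p.422 (bookkeeping)] -/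
theorem hKernelR_e (H : B9.HKernel (geo9Y x) (bg9Y 𝔸 G x)) : (hKernelR R₁ R₂ H).e = H.e := rfl
/-- same entries. [cite: Balaban1985BackgroundPropagators, (3.133) p.422 (bookkeeping)] -/
theorem hKernelR_h (H : B9.HKernel (geo9Y x) (bg9Y 𝔸 G x)) : (hKernelR R₁ R₂ H).h = H.h := rfl

/-- at MODULE 3's families the re-typing is the identity (structure eta). [cite: Balaban1985BackgroundPropagators, p.397 (bookkeeping)] -/
theorem kernelFamilyR_regY (K : B9.KernelFamily (geo9Y x) (bg9Y 𝔸 G x)) :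
    kernelFamilyR (regY335 𝔸 G) (regY336 𝔸 G) K = K := rfl
/-- at MODULE 3's families the re-typed `H`-kernel is the identity. [cite: Balaban1985BackgroundPropagators, p.422 (bookkeeping)] -/
theorem hKernelR_regY (H : B9.HKernel (geo9Y x) (bg9Y 𝔸 G x)) :
    hKernelR (regY335 𝔸 G) (regY336 𝔸 G) H = H := rfl

end Retype

end Literature.MathematicalPhysics.QuantumFieldTheory.Balaban1983to89.B9BackgroundsKLevelV1R

end
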